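import Summits.QuantumFields.BalabanUV.T4Continuum.Support.ShellMeasureLiveEndOneCallSlotLevels
import Summits.QuantumFields.BalabanUV.T4Continuum.Support.ShellMeasureLiveEndOneCallGibbs
import Summits.QuantumFields.BalabanUV.T4Continuum.Support.ShellMeasureRootCompositionSync

/-!
# `T4Continuum.ShellMeasureLiveEndOneCallUnionLevels` — row S92 file 3: THE ONE CALL WITH BOTH KINDS OF LIVE SLOTS — the Gibbs slots
# `S₀ r K` (lattice level 0, the LEVEL-0 FACE of record: leaf-06-g7's f1b) ⊔ the background-mediated slots `S₁ r K` (S80 f3: file 1)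
(cell `pub-balaban`, sub-cell `t4`, NE7c (node U5b); crew unit `b2b-balaban-t4-ne7c-formalise-leaf-09` gen 12; owner table row **S92**, ruling
R-ne7cp1-g33-5 (b) «file 2 takes `S r K := S₀ r K ∪ S₁ r K` DISJOINT» on leaf-06-g7's Q4; imports file 1 `ShellMeasureLiveEndOneCallSlotLevels`
(p231081), f1b `ShellMeasureLiveEndOneCallGibbs` (leaf-06-g7, p231442) and S27 `ShellMeasureRootCompositionSync` ONLY; [folklore]; 0 `def`,
0 `def … : Prop`, 0 sorry, 0 cite; END-II block generated by files 1∕2's script in «inr» mode)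

HONEST FRAMING.  Finite four-torus programme, rung (B)+1 only — NOT infinite volume, NOT a mass gap, NOT the Clay problem, NOT
summit progress; (B), `BetaPertHyp`, (B^μ) not consumed.  NE7c (`T4IndicatorShell.ShellWeightBound`) is NOT PRINTED in
[Balaban 1983–89] and NOT PROVED; «NE7c ⇐ the named binders» (trigger c3): every binder below is DISPLAYED, asserted by nobody;
no estimate of Bałaban's is discharged; (M1)₀ ∕ (M1) realized ≠ NE7c.  THIS declaration IS the countdown's object at the live
levels (level-0 slots served by the level-0 face); landing it moves NOTHING by itself.  HONEST DEPENDENCY (cell): continuum YM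
on T⁴ ⇐ BetaPertH ∧ nine spine estimates (0/9 proved); BetaPertH ⇐ (D1) ∧ (D4) ∧ CAP+tail; G-an2-4 gates asym, D1 and NE2/3/4.

WHAT IS PROVED ([folklore]).  **`shellWeightBound_live_oneCall_union_levels`** — the one-call END with the slot type a SUM `σ₀ ⊕ σ₁`:
END-I's slot sets `(S₀ r K).disjSum (S₁ r K)`, slot data `P jl lvl F u` on the sum type; on `Sum.inr s` EVERY S80 f3 binder as an
`(r, K, t, s)`-family (file 1's list; shared level-free numbers, profiles `ε η ρ β`) + the slot→level majorant `hDslot` guarded on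
`S₁`; on `Sum.inl s` leaf-06-g7's GIBBS family (S1's box data by `(r, K, s)`, (SM)₀ at the fine and co-test thresholds, `hD₀`, the
[dict] identification `hF₀`∕`hu₀` on `S₀`); END-I's rows VERBATIM over the disjoint sums.  PROOF: `Finset.mem_disjSum` cases — inl
by f1b `hac_gibbs_of_identified`, inr by file 1 lifted with `slotAntiConcentration_mono` — into S27 `shellWeightBound_of_towerData_sync`
(G := SU2, `DslotX := DX ∘ lvlX`).  CONCLUSION LITERALLY `ShellWeightBound l₀ T A B shA shB (fun K => Σ over the two disjoint sums)`;
(t1)–(t4) as file 2; (x1): S88 ∕ S89 f1–f4 by pointer. ROW S95 (R-ne7cp1-g34-1): the END-II block RE-TYPED over file 1′ — `κr κc κwb κcb dbar Kw` by lattice level `jl r K (Sum.inr s)` (F-ne7cL05g9-1 ∕ F-ne7cp1-g34-1); the Gibbs block unchanged (the finding does not bite it, leaf-06-g7 l.≈19655).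
-/

noncomputable section

open Set Metric NormedSpace MeasureTheory Function Finset
open scoped ENNReal

namespace Summit.QuantumFields.BalabanUV.T4Continuum.ShellMeasureLiveEndOneCallUnionLevels

open Literature.MathematicalPhysics.QuantumFieldTheory.Balaban1983to89
open B11Prop6Scheme (Prop4Hyp)
open GaugeField (GaugeInvariant)
open T4IndicatorShell (ShellWeightBound)
open T4ShellMeasure (SlotAntiConcentration)
open T4ShellMeasureLevels (LiveWindow)
open T4ShellMeasureFibre (slotAntiConcentration_mono)
open T4CubePoincare (cube)
open T4CubeChartGnomonic (SU2)
open T4CubeChartExp (expFibreChart)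
open T4TreeGaugeFixing (NoClosedLoop fixTo)
open T4AxialGaugeFixing (combBonds)
open T4AxialGaugeSmallField (boxPlaqs boxBonds)
open T4ShellMeasurePlaquette (expTail₂)
open ShellMeasureLevelAssembly (classifier)
open ShellMeasureMultiGridNorms (WSup)
open ShellMeasurePinnedNorm (pinW)
open ShellMeasureDecayKernelSums (kerOp)
open ShellMeasureLandauHolonomy (solAt landauExp)
open ShellMeasureLandauHolonomyChart (holOf cplx)
open ShellMeasureLandauHolonomySkew (readOutReal)
open ShellMeasureWilsonRealizedSU2 (wilsonU)
open ShellMeasureWilsonGaugeInvariant (giF)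
open ShellMeasureRootCompositionSync (shellWeightBound_of_towerData_sync)
open ShellMeasureLiveEndOneCallSlotLevels (hac_live_of_assembled_decay_levels)
open ShellMeasureLiveEndOneCallGibbs (hac_gibbs_of_identified)
open scoped Matrix.Norms.L2Operator

variable {σ₀ σ₁ : Type*} {n : Type*} [Fintype n] [DecidableEq n] [Nonempty n]

/-- **`ShellWeightBound` ⇐ THE NAMED BINDERS AT THE LIVE LEVELS, GIBBS SLOTS ⊔ BACKGROUND-MEDIATED SLOTS** (module docstring);
CONDITIONAL on every displayed binder; nothing PRINTED is asserted; NOT Bałaban's minimiser; NE7c NOT proved. [folklore] -/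
theorem shellWeightBound_live_oneCall_union_levels
    (P : Bool → ℕ → σ₀ ⊕ σ₁ → Params) (jl lvl : Bool → ℕ → σ₀ ⊕ σ₁ → ℕ) [∀ r K s, DecidableEq (PBond (P r K s) (jl r K s))]
    {ε η ρ β D : Bool → ℕ → ℝ} (hη : ∀ r j, 0 < η r j) (hε : ∀ r a, 0 < ε r a) (hρ0 : ∀ r j, 0 ≤ ρ r j) (hD0 : ∀ r j, 0 ≤ D r j)
    (S₀ : Bool → ℕ → Finset σ₀) (S₁ : Bool → ℕ → Finset σ₁) {l₀ : ℝ}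
    (F : ∀ r K (t : ℝ) (s : σ₀ ⊕ σ₁), GaugeField (P r K s) (jl r K s) SU2 → ℝ≥0∞)
    (u : ∀ r K (t : ℝ) (s : σ₀ ⊕ σ₁), GaugeField (P r K s) (jl r K s) SU2 → ℝ)
    -- ══ ON `Sum.inr s` (s : σ₁): EVERY END-II binder of S80 f3 as an (r, K, t, s)-family — file 1's list in «inr» form ══
    {𝒴 𝒴' 𝒳 𝒵 ℬ : Bool → ℕ → σ₁ → Type*} [∀ r K s, NormedAddCommGroup (𝒴 r K s)] [∀ r K s, NormedSpace ℂ (𝒴 r K s)]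
    [∀ r K s, CompleteSpace (𝒴 r K s)] [∀ r K s, NormedAddCommGroup (𝒴' r K s)] [∀ r K s, NormedSpace ℂ (𝒴' r K s)]
    [∀ r K s, NormedAddCommGroup (𝒳 r K s)] [∀ r K s, NormedSpace ℂ (𝒳 r K s)] [∀ r K s, CompleteSpace (𝒳 r K s)]
    [∀ r K s, NormedAddCommGroup (𝒵 r K s)] [∀ r K s, NormedSpace ℂ (𝒵 r K s)] [∀ r K s, NormedAddCommGroup (ℬ r K s)]
    [∀ r K s, NormedSpace ℂ (ℬ r K s)] {Tr : ∀ r K s, Finset (PBond (P r K (Sum.inr s)) (jl r K (Sum.inr s)))}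
    (hT : ∀ r K s, NoClosedLoop (Tr r K s)) (U₀ : ∀ r K (t : ℝ) s, GaugeField (P r K (Sum.inr s)) (jl r K (Sum.inr s)) SU2)
    (Λ : ∀ r K s, Finset (PBond (P r K (Sum.inr s)) (jl r K (Sum.inr s)))) {m₀ : Bool → ℕ → σ₁ → ℕ}
    (e : ∀ r K s, ↥(Λ r K s) × Fin 3 ≃ Fin (m₀ r K s)) {S : ℝ} (hS : 0 < S) (hSπ : 3 * S ^ 2 < Real.pi ^ 2)
    (ctr : ∀ r K (t : ℝ) s, GaugeField (P r K (Sum.inr s)) (jl r K (Sum.inr s)) SU2 → GaugeField (P r K (Sum.inr s)) (jl r K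
      (Sum.inr s)) SU2)
    (hF : ∀ r K t s, Measurable (F r K t (Sum.inr s))) (hFi : ∀ r K t s, GaugeInvariant (F r K t (Sum.inr s)))
    (hFsupp : ∀ r K t s, ∀ V y, F r K t (Sum.inr s) (fixTo (Tr r K s) (U₀ r K t s) (updateFinset V (Λ r K s) y)) ≠ 0 → ∀ b (hb :
      b ∈ Λ r K s), dist1 ((ctr r K t s V b)⁻¹ * y ⟨b, hb⟩) ≤ 2 * Real.sin (S / 2))
    (hu : ∀ r K t s, Measurable (u r K t (Sum.inr s))) (hui : ∀ r K t s, GaugeInvariant (u r K t (Sum.inr s)))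
    {ιc : Bool → ℕ → σ₁ → Type*} {Pu : ∀ r K (t : ℝ) s, Finset (ιc r K s)} (hPu : ∀ r K t s, (Pu r K t s).Nonempty)
    (W : ∀ r K (t : ℝ) s, GaugeField (P r K (Sum.inr s)) (jl r K (Sum.inr s)) SU2 → Set (Fin (m₀ r K s) → ℝ))
    (Jco : ∀ r K (t : ℝ) s, GaugeField (P r K (Sum.inr s)) (jl r K (Sum.inr s)) SU2 → (Fin (m₀ r K s) → ℝ) → ℝ≥0∞) {δ : ℝ}
    (𝒢 : ∀ r K (t : ℝ) s, GaugeField (P r K (Sum.inr s)) (jl r K (Sum.inr s)) SU2 → (𝒵 r K s →L[ℂ] (𝒴 r K s)))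
    (W𝒱 : ∀ r K (t : ℝ) s, GaugeField (P r K (Sum.inr s)) (jl r K (Sum.inr s)) SU2 → 𝒴 r K s → 𝒵 r K s) {B₀ C₄ a₃ ε₄ : ℝ}
    (h𝒢 : ∀ r K t s, ∀ V f, ‖𝒢 r K t s V f‖ ≤ B₀ * ‖f‖) (hW : ∀ r K t s, ∀ V, Prop4Hyp (W𝒱 r K t s V) C₄ a₃) (hB₀ : 0 < B₀)
    (hC₄ : 0 ≤ C₄) (hε₄ : 0 ≤ ε₄) {dL C₁ B₃ ε₁ : ℝ} (hdL : 0 ≤ dL) (hC₁ : 0 ≤ C₁) (hε₁ : 0 ≤ ε₁) (hB₃ : dL ≤ B₃)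
    (h1 : 2 * B₀ * C₁ * B₃ * ε₁ ≤ ε₄) (h2 : 4 * ε₄ ≤ a₃) (h3 : 16 * B₀ * C₄ * ε₄ ≤ 1)
    (H₁ : ∀ r K (t : ℝ) s, GaugeField (P r K (Sum.inr s)) (jl r K (Sum.inr s)) SU2 → (ℬ r K s →L[ℂ] (𝒴 r K s)))
    (hH₁ : ∀ r K t s, ∀ V B, ‖H₁ r K t s V B‖ ≤ B₀ * ‖B‖)
    (Φ : ∀ r K (t : ℝ) s, GaugeField (P r K (Sum.inr s)) (jl r K (Sum.inr s)) SU2 → (Fin (m₀ r K s) → ℂ) → ℬ r K s) {rΦ : ℝ}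
    (hΦd : ∀ r K t s, ∀ V, DifferentiableOn ℂ (Φ r K t s V) (ball 0 rΦ)) (hΦ0 : ∀ r K t s, ∀ V, Φ r K t s V 0 = 0)
    (hΦ : ∀ r K t s, ∀ V, ∀ z ∈ ball (0 : Fin (m₀ r K s) → ℂ) rΦ, ‖Φ r K t s V z‖ < 2 * dL * C₁ * ε₁) (hSr : S < rΦ)
    (Cf : ∀ r K (t : ℝ) s, GaugeField (P r K (Sum.inr s)) (jl r K (Sum.inr s)) SU2 → 𝒴' r K s → 𝒳 r K s) {C₂ RC : ℝ}
    (hC₂ : 0 ≤ C₂) (hCq : ∀ r K t s, ∀ V, ∀ Z : 𝒴' r K s, ‖Z‖ < RC → ‖Cf r K t s V Z‖ ≤ C₂ * ‖Z‖ ^ 2)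
    (hCd : ∀ r K t s, ∀ V, DifferentiableOn ℂ (Cf r K t s V) (ball 0 RC))
    (ιs : ∀ r K (t : ℝ) s, GaugeField (P r K (Sum.inr s)) (jl r K (Sum.inr s)) SU2 → (𝒴 r K s →L[ℂ] (𝒴' r K s)))
    (hι : ∀ r K t s, ∀ V Y, ‖ιs r K t s V Y‖ ≤ ‖Y‖)
    (Hop : ∀ r K (t : ℝ) s, GaugeField (P r K (Sum.inr s)) (jl r K (Sum.inr s)) SU2 → (𝒳 r K s →L[ℂ] (𝒴 r K s)))
    (hH : ∀ r K t s, ∀ V X, ‖Hop r K t s V X‖ ≤ B₀ * ‖X‖) {ε₃ : ℝ} (h18 : 18 * C₂ * B₀ * ε₃ ≤ 1)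
    (hcoup : ε₄ + B₀ * (2 * dL * C₁ * ε₁) ≤ ε₃) (h3R : 3 * ε₃ ≤ RC)
    (ℓs : ∀ r K (t : ℝ) s, ιc r K s → List (𝒴 r K s →L[ℂ] Matrix n n ℂ)) {κr : Bool → ℕ → ℝ}
    (hκ : ∀ r K s, 0 ≤ κr r (jl r K (Sum.inr s)))
    (hℓ : ∀ r K t s, ∀ p ∈ Pu r K t s, ∀ ℓ ∈ ℓs r K t s p, ∀ Y, ‖ℓ Y‖ ≤ κr r (jl r K (Sum.inr s)) * ‖Y‖) {m : ℕ}
    (hlen : ∀ r K t s, ∀ p ∈ Pu r K t s, (ℓs r K t s p).length ≤ m) {κc : Bool → ℕ → ℝ}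
    (hκc : ∀ r K s, 0 ≤ κc r (jl r K (Sum.inr s)))
    (hcurl : ∀ r K t s, ∀ p ∈ Pu r K t s, ∀ Y, ‖((ℓs r K t s p).map fun ℓ => ℓ Y).sum‖ ≤ κc r (jl r K (Sum.inr s)) * ‖Y‖)
    {Λw Λz Λw' Λx Λb 𝔖 : Bool → ℕ → σ₁ → Type*} [∀ r K s, Fintype (Λw r K s)] [∀ r K s, DecidableEq (Λw r K s)]
    [∀ r K s, Fintype (Λz r K s)] [∀ r K s, Fintype (Λw' r K s)] [∀ r K s, Fintype (Λx r K s)] [∀ r K s, Fintype (Λb r K s)]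
    {𝔄w ℭ 𝔄' 𝔅 𝔇 : Bool → ℕ → σ₁ → Type*} [∀ r K s, NormedAddCommGroup (𝔄w r K s)] [∀ r K s, NormedSpace ℂ (𝔄w r K s)]
    [∀ r K s, CompleteSpace (𝔄w r K s)] [∀ r K s, NormedAddCommGroup (ℭ r K s)] [∀ r K s, NormedSpace ℂ (ℭ r K s)]
    [∀ r K s, NormedAddCommGroup (𝔄' r K s)] [∀ r K s, NormedSpace ℂ (𝔄' r K s)] [∀ r K s, NormedAddCommGroup (𝔅 r K s)]
    [∀ r K s, NormedSpace ℂ (𝔅 r K s)] [∀ r K s, CompleteSpace (𝔅 r K s)] [∀ r K s, NormedAddCommGroup (𝔇 r K s)]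
    [∀ r K s, NormedSpace ℂ (𝔇 r K s)] {δw : ℝ} (hδw : 0 ≤ δw) (ϖw : ∀ r K (t : ℝ) s, 𝔖 r K s → ℝ)
    (dis : ∀ r K (t : ℝ) s, 𝔖 r K s → 𝔖 r K s → ℝ) (hϖw : ∀ r K t s, ∀ x y, ϖw r K t s x ≤ ϖw r K t s y + dis r K t s x y)
    (pos : ∀ r K (t : ℝ) s, Λw r K s → 𝔖 r K s) (posz : ∀ r K (t : ℝ) s, Λz r K s → 𝔖 r K s)
    (pos' : ∀ r K (t : ℝ) s, Λw' r K s → 𝔖 r K s) (posx : ∀ r K (t : ℝ) s, Λx r K s → 𝔖 r K s)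
    (posb : ∀ r K (t : ℝ) s, Λb r K s → 𝔖 r K s)
    (k𝒢 : ∀ r K (t : ℝ) s, GaugeField (P r K (Sum.inr s)) (jl r K (Sum.inr s)) SU2 → Λw r K s → Λz r K s → (ℭ r K s →L[ℂ] (𝔄w r
      K s)))
    (kι : ∀ r K (t : ℝ) s, GaugeField (P r K (Sum.inr s)) (jl r K (Sum.inr s)) SU2 → Λw' r K s → Λw r K s → (𝔄w r K s →L[ℂ] (𝔄'
      r K s)))
    (kH : ∀ r K (t : ℝ) s, GaugeField (P r K (Sum.inr s)) (jl r K (Sum.inr s)) SU2 → Λw r K s → Λx r K s → (𝔅 r K s →L[ℂ] (𝔄w r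
      K s)))
    (kH₁ : ∀ r K (t : ℝ) s, GaugeField (P r K (Sum.inr s)) (jl r K (Sum.inr s)) SU2 → Λw r K s → Λb r K s → (𝔇 r K s →L[ℂ] (𝔄w r
      K s)))
    {c𝒢 δ𝒢 M𝒢 cι δι Mι cH δH MH cH₁ δH₁ MH₁ : ℝ} (hc𝒢 : 0 ≤ c𝒢) (hM𝒢 : 0 ≤ M𝒢)
    (hk𝒢 : ∀ r K t s, ∀ V c b', ‖k𝒢 r K t s V c b'‖ ≤ c𝒢 * Real.exp (-(δ𝒢 * dis r K t s (pos r K t s c) (posz r K t s b'))))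
    (hM𝒢' : ∀ r K t s, ∀ x, ∑ b', Real.exp (-((δ𝒢 - δw) * dis r K t s x (posz r K t s b'))) ≤ M𝒢) (hcι : 0 ≤ cι) (hMι : 0 ≤ Mι)
    (hkι : ∀ r K t s, ∀ V c b', ‖kι r K t s V c b'‖ ≤ cι * Real.exp (-(δι * dis r K t s (pos' r K t s c) (pos r K t s b'))))
    (hMι' : ∀ r K t s, ∀ x, ∑ b', Real.exp (-((δι - δw) * dis r K t s x (pos r K t s b'))) ≤ Mι) (hcH : 0 ≤ cH) (hMH : 0 ≤ MH)
    (hkH : ∀ r K t s, ∀ V c b', ‖kH r K t s V c b'‖ ≤ cH * Real.exp (-(δH * dis r K t s (pos r K t s c) (posx r K t s b'))))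
    (hMH' : ∀ r K t s, ∀ x, ∑ b', Real.exp (-((δH - δw) * dis r K t s x (posx r K t s b'))) ≤ MH) (hcH₁ : 0 ≤ cH₁)
    (hMH₁ : 0 ≤ MH₁)
    (hkH₁ : ∀ r K t s, ∀ V c b', ‖kH₁ r K t s V c b'‖ ≤ cH₁ * Real.exp (-(δH₁ * dis r K t s (pos r K t s c) (posb r K t s b'))))
    (hMH₁' : ∀ r K t s, ∀ x, ∑ b', Real.exp (-((δH₁ - δw) * dis r K t s x (posb r K t s b'))) ≤ MH₁)
    (W𝒱w : ∀ r K (t : ℝ) s, GaugeField (P r K (Sum.inr s)) (jl r K (Sum.inr s)) SU2 → (Λw r K s → 𝔄w r K s) → (Λz r K s → ℭ r K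
      s))
    {B₀w C₄w a₃w ε₄w bw : ℝ} (h𝒢w : ∀ r K t s, ∀ V f, ‖kerOp (k𝒢 r K t s V) f‖ ≤ B₀w * ‖f‖)
    (hWw : ∀ r K t s, ∀ V, Prop4Hyp (W𝒱w r K t s V) C₄w a₃w) (hB₀w : 0 < B₀w) (hC₄w : 0 ≤ C₄w) (hε₄w : 0 ≤ ε₄w)
    (hdomw : 2 * (ε₄w + B₀w * bw) ≤ a₃w) (hselfw : B₀w * C₄w * (ε₄w + B₀w * bw) ^ 2 ≤ ε₄w)
    (hcontrw : 4 * B₀w * C₄w * (ε₄w + B₀w * bw) < 1) (hH₁w : ∀ r K t s, ∀ V B, ‖kerOp (kH₁ r K t s V) B‖ ≤ B₀w * ‖B‖)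
    (Φw : ∀ r K (t : ℝ) s, GaugeField (P r K (Sum.inr s)) (jl r K (Sum.inr s)) SU2 → (Fin (m₀ r K s) → ℂ) → (Λb r K s → 𝔇 r K
      s))
    {rΦw : ℝ} (hΦdw : ∀ r K t s, ∀ V, DifferentiableOn ℂ (Φw r K t s V) (ball 0 rΦw))
    (hΦ0w : ∀ r K t s, ∀ V, Φw r K t s V 0 = 0)
    (hΦbw : ∀ r K t s, ∀ V, ∀ z ∈ ball (0 : Fin (m₀ r K s) → ℂ) rΦw, ‖Φw r K t s V z‖ < bw) (h2Sw : 2 * S ≤ rΦw)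
    (Cw : ∀ r K (t : ℝ) s, GaugeField (P r K (Sum.inr s)) (jl r K (Sum.inr s)) SU2 → (Λw' r K s → 𝔄' r K s) → (Λx r K s → 𝔅 r K
      s))
    {C₂w RCw : ℝ} (hC₂w : 0 ≤ C₂w)
    (hCqw : ∀ r K t s, ∀ V, ∀ Z : Λw' r K s → 𝔄' r K s, ‖Z‖ < RCw → ‖Cw r K t s V Z‖ ≤ C₂w * ‖Z‖ ^ 2)
    (hCdw : ∀ r K t s, ∀ V, DifferentiableOn ℂ (Cw r K t s V) (ball 0 RCw))
    (hιw : ∀ r K t s, ∀ V Y, ‖kerOp (kι r K t s V) Y‖ ≤ ‖Y‖) (hHw : ∀ r K t s, ∀ V X, ‖kerOp (kH r K t s V) X‖ ≤ B₀w * ‖X‖)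
    (hqw : 9 * C₂w * B₀w * (ε₄w + B₀w * bw) < 1) (hRCw : 6 * (ε₄w + B₀w * bw) ≤ RCw)
    (NW : ∀ r K (t : ℝ) s, Λz r K s → Λw r K s → Prop)
    (hlocW : ∀ r K t s, ∀ V, ∀ A A' : Λw r K s → 𝔄w r K s, ∀ c', (∀ b', NW r K t s c' b' → A b' = A' b') → W𝒱w r K t s V A c' =
      W𝒱w r K t s V A' c')
    {rW : ℝ} (hreachW : ∀ r K t s, ∀ c' b', NW r K t s c' b' → ϖw r K t s (posz r K t s c') - rW ≤ ϖw r K t s (pos r K t s b'))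
    (NC : ∀ r K (t : ℝ) s, Λx r K s → Λw' r K s → Prop)
    (hlocC : ∀ r K t s, ∀ V, ∀ A A' : Λw' r K s → 𝔄' r K s, ∀ c', (∀ b', NC r K t s c' b' → A b' = A' b') → Cw r K t s V A c' =
      Cw r K t s V A' c')
    {rC : ℝ} (hreachC : ∀ r K t s, ∀ c' b', NC r K t s c' b' → ϖw r K t s (posx r K t s c') - rC ≤ ϖw r K t s (pos' r K t s b'))
    (hsupp : ∀ r K t s, ∀ V, ∀ z : Fin (m₀ r K s) → ℂ, ∀ i, 0 < ϖw r K t s (posb r K t s i) → Φw r K t s V z i = 0)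
    (hqW : c𝒢 * M𝒢 * (2 * C₄w * a₃w * Real.exp (δw * rW)) < 1)
    (hk : 2 * C₂w * RCw * Real.exp (δw * rC) * (cι * Mι) * (cH * MH) < 1) {𝔭 : Bool → ℕ → σ₁ → Type*}
    (Pw : ∀ r K (t : ℝ) s, Finset (𝔭 r K s)) (ℓw : ∀ r K (t : ℝ) s, 𝔭 r K s → List ((Λw r K s → 𝔄w r K s) →L[ℂ] Matrix n n ℂ))
    (suppw : ∀ r K (t : ℝ) s, 𝔭 r K s → Finset (Λw r K s)) (ϖPw : ∀ r K (t : ℝ) s, 𝔭 r K s → ℝ)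
    (hblindw : ∀ r K t s, ∀ p ∈ Pw r K t s, ∀ ℓ ∈ ℓw r K t s p, ∀ A A' : Λw r K s → 𝔄w r K s, (∀ b' ∈ suppw r K t s p, A b' = A'
      b') → ℓ A = ℓ A')
    (hdepthw : ∀ r K t s, ∀ p ∈ Pw r K t s, ∀ b' ∈ suppw r K t s p, ϖPw r K t s p ≤ ϖw r K t s (pos r K t s b'))
    (hϖPw : ∀ r K t s, ∀ p ∈ Pw r K t s, 0 ≤ ϖPw r K t s p) {κwb κcb : Bool → ℕ → ℝ}
    (hκwb : ∀ r K s, 0 ≤ κwb r (jl r K (Sum.inr s))) (hκcb : ∀ r K s, 0 ≤ κcb r (jl r K (Sum.inr s)))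
    (hℓwb : ∀ r K t s, ∀ p ∈ Pw r K t s, ∀ ℓ ∈ ℓw r K t s p, ‖ℓ‖ ≤ κwb r (jl r K (Sum.inr s)))
    (hcurlw : ∀ r K t s, ∀ p ∈ Pw r K t s, ‖(ℓw r K t s p).sum‖ ≤ κcb r (jl r K (Sum.inr s))) {mw : ℕ}
    (hlenw : ∀ r K t s, ∀ p ∈ Pw r K t s, (ℓw r K t s p).length ≤ mw) (𝓡𝒴w : ∀ r K (t : ℝ) s, AddSubgroup (Λw r K s → 𝔄w r K s))
    (h𝓡𝒴w : ∀ r K t s, IsClosed (𝓡𝒴w r K t s : Set (Λw r K s → 𝔄w r K s)))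
    (𝓡𝒵w : ∀ r K (t : ℝ) s, AddSubgroup (Λz r K s → ℭ r K s)) (𝓡𝒴w' : ∀ r K (t : ℝ) s, AddSubgroup (Λw' r K s → 𝔄' r K s))
    (𝓡𝒳w : ∀ r K (t : ℝ) s, AddSubgroup (Λx r K s → 𝔅 r K s))
    (h𝓡𝒳w : ∀ r K t s, IsClosed (𝓡𝒳w r K t s : Set (Λx r K s → 𝔅 r K s)))
    (𝓡ℬw : ∀ r K (t : ℝ) s, AddSubgroup (Λb r K s → 𝔇 r K s))
    (h𝒢rw : ∀ r K t s, ∀ V, ∀ f ∈ 𝓡𝒵w r K t s, kerOp (k𝒢 r K t s V) f ∈ 𝓡𝒴w r K t s)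
    (hWrw : ∀ r K t s, ∀ V, ∀ Y ∈ 𝓡𝒴w r K t s, W𝒱w r K t s V Y ∈ 𝓡𝒵w r K t s)
    (hιrw : ∀ r K t s, ∀ V, ∀ Y ∈ 𝓡𝒴w r K t s, kerOp (kι r K t s V) Y ∈ 𝓡𝒴w' r K t s)
    (hHrw : ∀ r K t s, ∀ V, ∀ X ∈ 𝓡𝒳w r K t s, kerOp (kH r K t s V) X ∈ 𝓡𝒴w r K t s)
    (hCrw : ∀ r K t s, ∀ V, ∀ Z ∈ 𝓡𝒴w' r K t s, Cw r K t s V Z ∈ 𝓡𝒳w r K t s)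
    (hH₁rw : ∀ r K t s, ∀ V, ∀ B ∈ 𝓡ℬw r K t s, kerOp (kH₁ r K t s V) B ∈ 𝓡𝒴w r K t s)
    (hΦrw : ∀ r K t s, ∀ V, ∀ y : Fin (m₀ r K s) → ℝ, ‖y‖ ≤ S → Φw r K t s V (cplx y) ∈ 𝓡ℬw r K t s)
    (hskew : ∀ r K t s, ∀ p ∈ Pw r K t s, ∀ ℓ ∈ ℓw r K t s p, ∀ Y ∈ 𝓡𝒴w r K t s, ℓ Y ∈ skewAdjoint (Matrix n n ℂ))
    (Bp : ∀ r K (t : ℝ) s, GaugeField (P r K (Sum.inr s)) (jl r K (Sum.inr s)) SU2 → 𝔭 r K s → Matrix n n ℂ)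
    {d : ∀ r K (t : ℝ) s, 𝔭 r K s → ℝ} {dbar : Bool → ℕ → ℝ}
    (hBu : ∀ r K t s, ∀ V, ∀ p ∈ Pw r K t s, Bp r K t s V p ∈ unitary (Matrix n n ℂ))
    (hBd : ∀ r K t s, ∀ V, ∀ p ∈ Pw r K t s, ‖Bp r K t s V p - 1‖ ≤ d r K t s p)
    (hd : ∀ r K t s, ∀ p ∈ Pw r K t s, d r K t s p ≤ dbar r (jl r K (Sum.inr s)))
    (hdbar : ∀ r K s, 0 ≤ dbar r (jl r K (Sum.inr s))) {Kw : Bool → ℕ → ℝ}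
    (hKw : ∀ r K t s, ∑ p ∈ Pw r K t s, Real.exp (-(δw * ϖPw r K t s p)) ≤ Kw r (jl r K (Sum.inr s)))
    {Λe : Bool → ℕ → σ₁ → Type*} [∀ r K s, Fintype (Λe r K s)] {𝔄 : Bool → ℕ → σ₁ → Type*}
    [∀ r K s, NormedAddCommGroup (𝔄 r K s)] [∀ r K s, NormedSpace ℂ (𝔄 r K s)] [∀ r K s, CompleteSpace (𝔄 r K s)] {δ' : ℝ}
    {ϖ : ∀ r K (t : ℝ) s, Λe r K s → ℝ} (hδ' : 0 ≤ δ') (hϖ : ∀ r K t s, ∀ b', 0 ≤ ϖ r K t s b')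
    {𝒴e' 𝒳e 𝒵e ℬe : Bool → ℕ → σ₁ → Type*} [∀ r K s, NormedAddCommGroup (𝒴e' r K s)] [∀ r K s, NormedSpace ℂ (𝒴e' r K s)]
    [∀ r K s, NormedAddCommGroup (𝒳e r K s)] [∀ r K s, NormedSpace ℂ (𝒳e r K s)] [∀ r K s, CompleteSpace (𝒳e r K s)]
    [∀ r K s, NormedAddCommGroup (𝒵e r K s)] [∀ r K s, NormedSpace ℂ (𝒵e r K s)] [∀ r K s, NormedAddCommGroup (ℬe r K s)]
    [∀ r K s, NormedSpace ℂ (ℬe r K s)]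
    (𝒢e : ∀ r K t s, GaugeField (P r K (Sum.inr s)) (jl r K (Sum.inr s)) SU2 → (𝒵e r K s →L[ℂ] WSup (pinW δ' (ϖ r K t s)) 1 (𝔄 r
      K s)))
    (W𝒱e : ∀ r K t s, GaugeField (P r K (Sum.inr s)) (jl r K (Sum.inr s)) SU2 → WSup (pinW δ' (ϖ r K t s)) 1 (𝔄 r K s) → 𝒵e r K
      s)
    {B₀e C₄e a₃e be ε₄e : ℝ} (h𝒢e : ∀ r K t s, ∀ V f, ‖𝒢e r K t s V f‖ ≤ B₀e * ‖f‖)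
    (hWe : ∀ r K t s, ∀ V, Prop4Hyp (W𝒱e r K t s V) C₄e a₃e) (hB₀e : 0 < B₀e) (hC₄e : 0 ≤ C₄e) (hbe : 0 ≤ be) (hε₄e : 0 ≤ ε₄e)
    (hdome : 2 * (ε₄e + B₀e * be) ≤ a₃e) (hselfe : B₀e * C₄e * (ε₄e + B₀e * be) ^ 2 ≤ ε₄e)
    (hcontre : 4 * B₀e * C₄e * (ε₄e + B₀e * be) < 1)
    (H₁e : ∀ r K t s, GaugeField (P r K (Sum.inr s)) (jl r K (Sum.inr s)) SU2 → (ℬe r K s →L[ℂ] WSup (pinW δ' (ϖ r K t s)) 1 (𝔄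
      r K s)))
    (hH₁e : ∀ r K t s, ∀ V B, ‖H₁e r K t s V B‖ ≤ B₀e * ‖B‖)
    (Φe : ∀ r K (t : ℝ) s, GaugeField (P r K (Sum.inr s)) (jl r K (Sum.inr s)) SU2 → (Fin (m₀ r K s) → ℂ) → ℬe r K s) {rΦe : ℝ}
    (hΦde : ∀ r K t s, ∀ V, DifferentiableOn ℂ (Φe r K t s V) (ball 0 rΦe)) (hΦ0e : ∀ r K t s, ∀ V, Φe r K t s V 0 = 0)
    (hΦbe : ∀ r K t s, ∀ V, ∀ z ∈ ball (0 : Fin (m₀ r K s) → ℂ) rΦe, ‖Φe r K t s V z‖ < be) (hSre : S < rΦe)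
    (Ce : ∀ r K (t : ℝ) s, GaugeField (P r K (Sum.inr s)) (jl r K (Sum.inr s)) SU2 → 𝒴e' r K s → 𝒳e r K s) {C₂e RCe : ℝ}
    (hC₂e : 0 ≤ C₂e) (hCqe : ∀ r K t s, ∀ V, ∀ Z : 𝒴e' r K s, ‖Z‖ < RCe → ‖Ce r K t s V Z‖ ≤ C₂e * ‖Z‖ ^ 2)
    (hCde : ∀ r K t s, ∀ V, DifferentiableOn ℂ (Ce r K t s V) (ball 0 RCe))
    (ιe : ∀ r K t s, GaugeField (P r K (Sum.inr s)) (jl r K (Sum.inr s)) SU2 → (WSup (pinW δ' (ϖ r K t s)) 1 (𝔄 r K s) →L[ℂ]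
      (𝒴e' r K s)))
    (hιe : ∀ r K t s, ∀ V Y, ‖ιe r K t s V Y‖ ≤ ‖Y‖)
    (He : ∀ r K t s, GaugeField (P r K (Sum.inr s)) (jl r K (Sum.inr s)) SU2 → (𝒳e r K s →L[ℂ] WSup (pinW δ' (ϖ r K t s)) 1 (𝔄 r
      K s)))
    (hHe : ∀ r K t s, ∀ V X, ‖He r K t s V X‖ ≤ B₀e * ‖X‖) (hqe : 9 * C₂e * B₀e * (ε₄e + B₀e * be) < 1)
    (hRCe : 3 * (ε₄e + B₀e * be) ≤ RCe) {𝔱 : Bool → ℕ → σ₁ → Type*} (I : ∀ r K (t : ℝ) s, Finset (𝔱 r K s))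
    {Ef : ∀ r K (t : ℝ) s, 𝔱 r K s → (Λe r K s → 𝔄 r K s) → ℂ} {rE : ℝ} {ee : ∀ r K (t : ℝ) s, 𝔱 r K s → ℝ} (hrE : 0 < rE)
    (hEd : ∀ r K t s, ∀ i ∈ I r K t s, DifferentiableOn ℂ (Ef r K t s i) (ball 0 rE))
    (hEb : ∀ r K t s, ∀ i ∈ I r K t s, ∀ Z ∈ ball (0 : Λe r K s → 𝔄 r K s) rE, ‖Ef r K t s i Z‖ ≤ ee r K t s i)
    (he0 : ∀ r K t s, ∀ i ∈ I r K t s, 0 ≤ ee r K t s i) (supp : ∀ r K (t : ℝ) s, 𝔱 r K s → Finset (Λe r K s))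
    (hblind : ∀ r K t s, ∀ i ∈ I r K t s, ∀ A₁ A₂ : Λe r K s → 𝔄 r K s, (∀ b' ∈ supp r K t s i, A₁ b' = A₂ b') → Ef r K t s i A₁
      = Ef r K t s i A₂)
    (ϖP : ∀ r K (t : ℝ) s, 𝔱 r K s → ℝ)
    (hdepth : ∀ r K t s, ∀ i ∈ I r K t s, ∀ b' ∈ supp r K t s i, ϖP r K t s i ≤ ϖ r K t s b') {LK : ℝ} (hLK : 0 ≤ LK)
    (hK : ∀ r K t s, ∑ i ∈ I r K t s, 2 * ee r K t s i / rE * Real.exp (-(δ' * ϖP r K t s i)) ≤ LK)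
    (hcoupE : ((ε₄e + B₀e * be) + B₀e * (4 * C₂e * (ε₄e + B₀e * be) ^ 2)) ≤ rE / 2) {BE₁ : ℝ}
    (hElb₁ : ∀ r K t s, ∀ V (y : Fin (m₀ r K s) → ℝ), ‖y‖ ≤ S → -BE₁ ≤ (∑ i ∈ I r K t s, Ef r K t s i (WSup.toPiL (𝔄 := 𝔄 r K s)
      (pinW δ' (ϖ r K t s)) 1 (landauExp (Ce r K t s V) (ιe r K t s V) (He r K t s V) (4 * C₂e * (ε₄e + B₀e * be) ^ 2) (solAt
      (𝒢e r K t s V) 0 (W𝒱e r K t s V) ε₄e (0 : 𝒵e r K s) (H₁e r K t s V (Φe r K t s V (cplx y))) + H₁e r K t s V (Φe r K t s V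
      (cplx y)))))).re)
    {Ω : Bool → ℕ → σ₁ → Type*} [∀ r K s, MeasurableSpace (Ω r K s)] (μ : ∀ r K (t : ℝ) s, Measure (Ω r K s))
    {g : ∀ r K (t : ℝ) s, Ω r K s → ℝ} (hg : ∀ r K t s, ∀ ω, 0 ≤ g r K t s ω)
    (Aex : ∀ r K (t : ℝ) s, GaugeField (P r K (Sum.inr s)) (jl r K (Sum.inr s)) SU2 → (Fin (m₀ r K s) → ℝ) → Ω r K s → ℝ)
    {Bd : ℝ} (hBd0 : 0 ≤ Bd)
    (hint : ∀ r K t s, ∀ V, ∀ x ∈ W r K t s V, ∀ c : ℝ, 1 / 2 ≤ c → c ≤ 1 → Integrable (fun ω => g r K t s ω * Real.exp (Aex r K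
      t s V (c • x) ω)) (μ r K t s))
    (hpos : ∀ r K t s, ∀ V, ∀ x ∈ W r K t s V, ∀ c : ℝ, 1 / 2 ≤ c → c ≤ 1 → 0 < ∫ ω, g r K t s ω * Real.exp (Aex r K t s V (c •
      x) ω) ∂(μ r K t s))
    (hA : ∀ r K t s, ∀ V, ∀ x ∈ W r K t s V, ∀ c : ℝ, 1 / 2 ≤ c → c ≤ 1 → ∀ ω, Aex r K t s V x ω ≤ Aex r K t s V (c • x) ω + (1
      - c) * Bd)
    {BE₂ : ℝ}
    (hElb₂ : ∀ r K t s, ∀ V (y : Fin (m₀ r K s) → ℝ), ‖y‖ ≤ S → -BE₂ ≤ (-Real.log (∫ ω, g r K t s ω * Real.exp (Aex r K t s V y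
      ω) ∂(μ r K t s))))
    (L : ∀ r K (t : ℝ) s, Set (𝒴 r K s →L[ℂ] Matrix n n ℂ)) (𝓡𝒵 : ∀ r K (t : ℝ) s, AddSubgroup (𝒵 r K s))
    (𝓡𝒴' : ∀ r K (t : ℝ) s, AddSubgroup (𝒴' r K s)) (𝓡𝒳 : ∀ r K (t : ℝ) s, AddSubgroup (𝒳 r K s))
    (h𝓡𝒳 : ∀ r K t s, IsClosed (𝓡𝒳 r K t s : Set (𝒳 r K s))) (𝓡ℬ : ∀ r K (t : ℝ) s, AddSubgroup (ℬ r K s))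
    (h𝒢r : ∀ r K t s, ∀ V, ∀ f ∈ 𝓡𝒵 r K t s, 𝒢 r K t s V f ∈ readOutReal (L r K t s))
    (hWr : ∀ r K t s, ∀ V, ∀ Y ∈ readOutReal (L r K t s), W𝒱 r K t s V Y ∈ 𝓡𝒵 r K t s)
    (hιr : ∀ r K t s, ∀ V, ∀ Y ∈ readOutReal (L r K t s), ιs r K t s V Y ∈ 𝓡𝒴' r K t s)
    (hHr : ∀ r K t s, ∀ V, ∀ X ∈ 𝓡𝒳 r K t s, Hop r K t s V X ∈ readOutReal (L r K t s))
    (hCr : ∀ r K t s, ∀ V, ∀ Z ∈ 𝓡𝒴' r K t s, Cf r K t s V Z ∈ 𝓡𝒳 r K t s)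
    (hH₁r : ∀ r K t s, ∀ V, ∀ B ∈ 𝓡ℬ r K t s, H₁ r K t s V B ∈ readOutReal (L r K t s))
    (hΦr : ∀ r K t s, ∀ V, ∀ y : Fin (m₀ r K s) → ℝ, ‖y‖ ≤ S → Φ r K t s V (cplx y) ∈ 𝓡ℬ r K t s)
    (hRdict : ∀ r K t s, ∀ V, ∀ x ∈ cube (m₀ r K s) S, F r K t (Sum.inr s) (fixTo (Tr r K s) (U₀ r K t s) (updateFinset V (Λ r K
      s) (expFibreChart (Λ r K s) (ctr r K t s V) (e r K s) x))) = Jco r K t s V x * ENNReal.ofReal (Real.exp (-((∑ p ∈ Pw r K t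
      s, β r (jl r K (Sum.inr s)) * (1 - (Matrix.trace (Bp r K t s V p * holOf (ℓw r K t s p) (fun y => landauExp (Cw r K t s V)
      (kerOp (kι r K t s V)) (kerOp (kH r K t s V)) (4 * C₂w * (ε₄w + B₀w * bw) ^ 2) (solAt (kerOp (k𝒢 r K t s V)) 0 (W𝒱w r K t
      s V) ε₄w (0 : Λz r K s → ℭ r K s) (kerOp (kH₁ r K t s V) (Φw r K t s V (cplx y))) + kerOp (kH₁ r K t s V) (Φw r K t s V
      (cplx y)))) x)).re / Fintype.card n)) + ((∑ i ∈ I r K t s, Ef r K t s i (WSup.toPiL (𝔄 := 𝔄 r K s) (pinW δ' (ϖ r K t s)) 1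
      (landauExp (Ce r K t s V) (ιe r K t s V) (He r K t s V) (4 * C₂e * (ε₄e + B₀e * be) ^ 2) (solAt (𝒢e r K t s V) 0 (W𝒱e r K
      t s V) ε₄e (0 : 𝒵e r K s) (H₁e r K t s V (Φe r K t s V (cplx x))) + H₁e r K t s V (Φe r K t s V (cplx x)))))).re +
      (-Real.log (∫ ω, g r K t s ω * Real.exp (Aex r K t s V x ω) ∂(μ r K t s))))))))
    (hudict : ∀ r K t s, ∀ V, ∀ x ∈ cube (m₀ r K s) S, u r K t (Sum.inr s) (fixTo (Tr r K s) (U₀ r K t s) (updateFinset V (Λ r K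
      s) (expFibreChart (Λ r K s) (ctr r K t s V) (e r K s) x))) = classifier (hPu r K t s) (fun p => holOf (ℓs r K t s p) (fun
      y => landauExp (Cf r K t s V) (ιs r K t s V) (Hop r K t s V) (4 * C₂ * (ε₄ + B₀ * (2 * dL * C₁ * ε₁)) ^ 2) (solAt (𝒢 r K t
      s V) 0 (W𝒱 r K t s V) ε₄ (0 : 𝒵 r K s) (H₁ r K t s V (Φ r K t s V (cplx y))) + H₁ r K t s V (Φ r K t s V (cplx y))))) x)
    (hJW : ∀ r K t s, ∀ V x, Jco r K t s V x ≠ 0 → x ∈ W r K t s V)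
    (hJ : ∀ r K t s, ∀ V x, ∀ a : ℝ, 0 ≤ a → Jco r K t s V x ≤ Jco r K t s V (Real.exp (-a) • x))
    (hJ1 : ∀ r K t s, ∀ V x, Jco r K t s V x ≤ 1) (hWS : ∀ r K t s, ∀ V, W r K t s V ⊆ closedBall (0 : Fin (m₀ r K s) → ℝ) S)
    (hδ0 : 0 ≤ δ) (hδ1 : δ < 1) {c₁ c₂ zs : ℝ}
    (hs₁ : ∀ r K s, κc r (jl r K (Sum.inr s)) * ((ε₄ + B₀ * (2 * dL * C₁ * ε₁)) + B₀ * (4 * C₂ * (ε₄ + B₀ * (2 * dL * C₁ * ε₁))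
      ^ 2)) ≤ c₁ * η r (jl r K (Sum.inr s)) ^ 2 * zs)
    (ha : ∀ r K s, κr r (jl r K (Sum.inr s)) * ((ε₄ + B₀ * (2 * dL * C₁ * ε₁)) + B₀ * (4 * C₂ * (ε₄ + B₀ * (2 * dL * C₁ * ε₁)) ^
      2)) ≤ c₂ * η r (jl r K (Sum.inr s)) * zs)
    (hma : ∀ r K s, m * (κr r (jl r K (Sum.inr s)) * ((ε₄ + B₀ * (2 * dL * C₁ * ε₁)) + B₀ * (4 * C₂ * (ε₄ + B₀ * (2 * dL * C₁ *
      ε₁)) ^ 2))) ≤ 1)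
    (hsm : ∀ r K s, 36 * (c₁ * zs + m ^ 2 * c₂ ^ 2 * zs ^ 2) / (rΦ / S - 1) ^ 2 ≤ δ * ε r (K - lvl r K (Sum.inr s)))
    (hρ : ∀ r j, ρ r j ≤ (1 - δ) / 2) (hβ : ∀ r j, 0 ≤ β r j)
    -- the slot → level majorant on the END-II slots: S80 f3's constant (written out ONCE), guarded on `S₁ r K`
    (hDslot : ∀ r K t, |t| ≤ l₀ → ∀ s ∈ S₁ r K, 2 * ((m₀ r K s : ℝ) + (3 * (|β r (jl r K (Sum.inr s))| * ((dbar r (jl r K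
      (Sum.inr s)) + 2 * (κcb r (jl r K (Sum.inr s)) * (cH₁ * MH₁ * bw / ((1 - c𝒢 * M𝒢 * (2 * C₄w * a₃w * Real.exp (δw * rW))) *
      (1 - 2 * C₂w * RCw * Real.exp (δw * rC) * (cι * Mι) * (cH * MH)))) + expTail₂ (mw * (κwb r (jl r K (Sum.inr s)) * (cH₁ *
      MH₁ * bw / ((1 - c𝒢 * M𝒢 * (2 * C₄w * a₃w * Real.exp (δw * rW))) * (1 - 2 * C₂w * RCw * Real.exp (δw * rC) * (cι * Mι) *
      (cH * MH))))))) / (rΦw / S)) * (2 * (κcb r (jl r K (Sum.inr s)) * (cH₁ * MH₁ * bw / ((1 - c𝒢 * M𝒢 * (2 * C₄w * a₃w *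
      Real.exp (δw * rW))) * (1 - 2 * C₂w * RCw * Real.exp (δw * rC) * (cι * Mι) * (cH * MH)))) + expTail₂ (mw * (κwb r (jl r K
      (Sum.inr s)) * (cH₁ * MH₁ * bw / ((1 - c𝒢 * M𝒢 * (2 * C₄w * a₃w * Real.exp (δw * rW))) * (1 - 2 * C₂w * RCw * Real.exp (δw
      * rC) * (cι * Mι) * (cH * MH))))))) / (rΦw / S))) * Kw r (jl r K (Sum.inr s))) + (3 * (LK * (2 * ((ε₄e + B₀e * be) + B₀e *
      (4 * C₂e * (ε₄e + B₀e * be) ^ 2)))) / (rΦe / S - 1) + Bd))) / (1 - δ) ≤ D r (lvl r K (Sum.inr s)))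
    -- ══ ON `Sum.inl s` (s : σ₀): THE GIBBS SLOTS — f1b `hac_gibbs_of_identified`'s binders (box data, (SM)₀, `hD₀`, `hF₀`∕`hu₀`) ══
    (lo hi : ∀ r K (s : σ₀), Fin (P r K (Sum.inl s)).d → ℤ) {mb : Bool → ℕ → σ₀ → ℕ}
    (hN : ∀ r K s κ, hi r K s κ - lo r K s κ < (P r K (Sum.inl s)).sitesPerDir (jl r K (Sum.inl s)))
    (hm : ∀ r K s κ, hi r K s κ ≤ lo r K s κ + mb r K s)
    (Λg : ∀ r K (s : σ₀), Finset (PBond (P r K (Sum.inl s)) (jl r K (Sum.inl s))))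
    (hΛbox : ∀ r K s, ∀ b ∈ Λg r K s, b ∈ boxBonds (lo r K s) (hi r K s))
    (hΛcomb : ∀ r K s, Disjoint (Λg r K s) (combBonds (lo r K s) (hi r K s)))
    (hcov : ∀ r K s, ∀ b ∈ boxBonds (lo r K s) (hi r K s), b ∉ Λg r K s →
      b ∈ (combBonds (lo r K s) (hi r K s) : Finset (PBond (P r K (Sum.inl s)) (jl r K (Sum.inl s)))))
    {m₀g : Bool → ℕ → σ₀ → ℕ} (eg : ∀ r K s, ↥(Λg r K s) × Fin 3 ≃ Fin (m₀g r K s))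
    {S0 : ℝ} (hS0 : 0 < S0) (hS08 : S0 ≤ 1 / 8) (hS0π : 3 * S0 ^ 2 < Real.pi ^ 2)
    {σc : Bool → ℕ → σ₀ → ℝ} (hσ : ∀ r K s, 0 < σc r K s)
    (hrad : ∀ r K s, (((P r K (Sum.inl s)).d - 1 : ℕ) : ℝ) * mb r K s * σc r K s ≤ 2 * S0 / Real.pi)
    {Pug : ∀ r K (s : σ₀), Finset (Plaq (P r K (Sum.inl s)) (jl r K (Sum.inl s)))} (hPug : ∀ r K s, (Pug r K s).Nonempty)
    (hPubox : ∀ r K s, ∀ p ∈ Pug r K s, p ∈ boxPlaqs (lo r K s) (hi r K s))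
    (Pwg : ∀ r K (s : σ₀), Finset (Plaq (P r K (Sum.inl s)) (jl r K (Sum.inl s))))
    (hSM : ∀ r K s, 4 * (8 * S0) ^ 2 * Real.exp (2 * (8 * S0)) ≤ δ * (ε r (K - lvl r K (Sum.inl s)) * η r (jl r K (Sum.inl s)) ^ 2))
    (hSMσ : ∀ r K s, 4 * (8 * S0) ^ 2 * Real.exp (2 * (8 * S0)) ≤ δ * σc r K s)
    (hD₀ : ∀ r K s, 2 * ((m₀g r K s : ℝ) + β r (jl r K (Sum.inl s)) * ∑ _p ∈ Pwg r K s, (8 * S0) * (8 + 4 * (8 * S0))) / (1 - δ) ≤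
      D r (lvl r K (Sum.inl s)))
    (hF₀ : ∀ r K t, ∀ s ∈ S₀ r K, F r K t (Sum.inl s) = giF (lo r K s) (hi r K s) (σc r K s) (β r (jl r K (Sum.inl s))) (Pwg r K s))
    (hu₀ : ∀ r K t, ∀ s ∈ S₀ r K, u r K t (Sum.inl s) = wilsonU (hPug r K s))
    -- ══ END-I's own rows over the DISJOINT SUMS ((R)+[dict], finiteness, `LiveWindow` ×2, `0 < ϑ < 1`, `D ≤ D̄`, rates) ══
    {ι : Type*} {T : ℕ → Finset ι} {A B shA shB : ℕ → ℝ → ι → ℝ}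
    {pieceA pieceB : ℕ → ℝ → σ₀ ⊕ σ₁ → ι → ℝ} {MA MB : ℕ → ℝ → σ₀ ⊕ σ₁ → ℝ} {N₁ : ℕ} {νbar Dbar crate ϑ : ℝ}
    (hFfin : ∀ r K t s, ∫⁻ U, F r K t s U ∂(fieldMeasure (P r K s) (jl r K s) SU2) ≠ ∞)
    (sh_nonnegA : ∀ K t, |t| ≤ l₀ → ∀ τ ∈ T K, 0 ≤ shA K t τ)
    (sh_leA : ∀ K t, |t| ≤ l₀ → ∀ τ ∈ T K, shA K t τ ≤ A K t τ)
    (coverA : ∀ K t, |t| ≤ l₀ → ∀ τ ∈ T K, shA K t τ ≤ ∑ s ∈ (S₀ true K).disjSum (S₁ true K), pieceA K t s τ)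
    (hMA : ∀ K t, |t| ≤ l₀ → ∀ s ∈ (S₀ true K).disjSum (S₁ true K), 0 ≤ MA K t s)
    (piece_leA : ∀ K t, |t| ≤ l₀ → ∀ s ∈ (S₀ true K).disjSum (S₁ true K), ∑ τ ∈ T K, pieceA K t s τ ≤ MA K t s *
      (((fieldMeasure (P true K s) (jl true K s) SU2).withDensity (F true K t s))
        {x | ε true (K - lvl true K s) * (1 - ρ true (lvl true K s)) ≤ u true K t s x / η true (jl true K s) ^ 2 ∧
          u true K t s x / η true (jl true K s) ^ 2 < ε true (K - lvl true K s)}).toReal)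
    (total_geA : ∀ K t, |t| ≤ l₀ → ∀ s ∈ (S₀ true K).disjSum (S₁ true K),
      MA K t s * (((fieldMeasure (P true K s) (jl true K s) SU2).withDensity (F true K t s)) Set.univ).toReal ≤
        ∑ τ ∈ T K, A K t τ)
    (sh_nonnegB : ∀ K t, |t| ≤ l₀ → ∀ τ ∈ T K, 0 ≤ shB K t τ)
    (sh_leB : ∀ K t, |t| ≤ l₀ → ∀ τ ∈ T K, shB K t τ ≤ B K t τ)
    (coverB : ∀ K t, |t| ≤ l₀ → ∀ τ ∈ T K, shB K t τ ≤ ∑ s ∈ (S₀ false K).disjSum (S₁ false K), pieceB K t s τ)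
    (hMB : ∀ K t, |t| ≤ l₀ → ∀ s ∈ (S₀ false K).disjSum (S₁ false K), 0 ≤ MB K t s)
    (piece_leB : ∀ K t, |t| ≤ l₀ → ∀ s ∈ (S₀ false K).disjSum (S₁ false K), ∑ τ ∈ T K, pieceB K t s τ ≤ MB K t s *
      (((fieldMeasure (P false K s) (jl false K s) SU2).withDensity (F false K t s))
        {x | ε false (K - lvl false K s) * (1 - ρ false (lvl false K s)) ≤ u false K t s x / η false (jl false K s) ^ 2 ∧
          u false K t s x / η false (jl false K s) ^ 2 < ε false (K - lvl false K s)}).toReal)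
    (total_geB : ∀ K t, |t| ≤ l₀ → ∀ s ∈ (S₀ false K).disjSum (S₁ false K),
      MB K t s * (((fieldMeasure (P false K s) (jl false K s) SU2).withDensity (F false K t s)) Set.univ).toReal ≤
        ∑ τ ∈ T K, B K t τ)
    (hw : ∀ r, LiveWindow (fun K => (S₀ r K).disjSum (S₁ r K)) (lvl r) N₁ νbar) (hϑ0 : 0 < ϑ) (hϑ1 : ϑ < 1)
    (hDbar : ∀ r j, D r j ≤ Dbar) (hrate : ∀ r j, ρ r j ≤ crate * ϑ ^ j) :
    ShellWeightBound l₀ T A B shA shB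
      (fun K => ∑ s ∈ (S₀ true K).disjSum (S₁ true K), D true (lvl true K s) * ρ true (lvl true K s) +
        ∑ s ∈ (S₀ false K).disjSum (S₁ false K), D false (lvl false K s) * ρ false (lvl false K s)) := by
  -- the background-mediated slots: file 1 (S80 f3 ∘ S90) at `s ↦ Sum.inr s`
  have hlive := hac_live_of_assembled_decay_levels (fun r K s => P r K (Sum.inr s)) (fun r K s => jl r K (Sum.inr s)) (fun r K s => lvl
    r K (Sum.inr s)) hη hε hρ0 hT U₀ Λ e hS hSπ ctr hF hFi hFsupp hu hui hPu W Jco 𝒢 W𝒱 h𝒢 hW hB₀ hC₄ hε₄ hdL hC₁ hε₁ hB₃ h1 h2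
    h3 H₁ hH₁ Φ hΦd hΦ0 hΦ hSr Cf hC₂ hCq hCd ιs hι Hop hH h18 hcoup h3R ℓs hκ hℓ hlen hκc hcurl hδw ϖw dis hϖw pos posz pos'
    posx posb k𝒢 kι kH kH₁ hc𝒢 hM𝒢 hk𝒢 hM𝒢' hcι hMι hkι hMι' hcH hMH hkH hMH' hcH₁ hMH₁ hkH₁ hMH₁' W𝒱w h𝒢w hWw hB₀w hC₄w hε₄w
    hdomw hselfw hcontrw hH₁w Φw hΦdw hΦ0w hΦbw h2Sw Cw hC₂w hCqw hCdw hιw hHw hqw hRCw NW hlocW hreachW NC hlocC hreachC hsupp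
    hqW hk Pw ℓw suppw ϖPw hblindw hdepthw hϖPw hκwb hκcb hℓwb hcurlw hlenw 𝓡𝒴w h𝓡𝒴w 𝓡𝒵w 𝓡𝒴w' 𝓡𝒳w h𝓡𝒳w 𝓡ℬw h𝒢rw hWrw hιrw hHrw
    hCrw hH₁rw hΦrw hskew Bp hBu hBd hd hdbar hKw hδ' hϖ 𝒢e W𝒱e h𝒢e hWe hB₀e hC₄e hbe hε₄e hdome hselfe hcontre H₁e hH₁e Φe hΦde
    hΦ0e hΦbe hSre Ce hC₂e hCqe hCde ιe hιe He hHe hqe hRCe I hrE hEd hEb he0 supp hblind ϖP hdepth hLK hK hcoupE hElb₁ μ hg Aex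
    hBd0 hint hpos hA hElb₂ L 𝓡𝒵 𝓡𝒴' 𝓡𝒳 h𝓡𝒳 𝓡ℬ h𝒢r hWr hιr hHr hCr hH₁r hΦr hRdict hudict hJW hJ hJ1 hWS hδ0 hδ1 hs₁ ha hma hsm
    hρ hβ
  -- the Gibbs slots: leaf-06-g7's f1b at `s ↦ Sum.inl s`
  have hgibbs := hac_gibbs_of_identified (fun r K s => P r K (Sum.inl s)) (fun r K s => jl r K (Sum.inl s))
    (fun r K s => lvl r K (Sum.inl s)) hη hε hρ0 lo hi hN hm Λg hΛbox hΛcomb hcov eg hS0 hS08 hS0π hσ hrad hPug hPubox Pwg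
    hδ0 hδ1 hρ hβ hSM hSMσ hD₀ S₀ (fun r K t s => F r K t (Sum.inl s)) (fun r K t s => u r K t (Sum.inl s)) hF₀ hu₀
  -- both kinds, at the level constant `D r (lvl r K s)`
  have hunion : ∀ (r : Bool) (K : ℕ) (t : ℝ), |t| ≤ l₀ → ∀ s ∈ (S₀ r K).disjSum (S₁ r K),
      SlotAntiConcentration ((fieldMeasure (P r K s) (jl r K s) SU2).withDensity (F r K t s))
        (fun U => u r K t s U / η r (jl r K s) ^ 2) (ε r (K - lvl r K s)) (ρ r (lvl r K s)) (D r (lvl r K s)) := by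
    intro r K t ht s hs
    rcases Finset.mem_disjSum.1 hs with ⟨a, ha, rfl⟩ | ⟨b, hb, rfl⟩
    · exact hgibbs r K t a ha
    · exact slotAntiConcentration_mono (hρ0 r _) (hDslot r K t ht b hb) (hlive r K t b)
  -- END-I (S27 §2: slot towers, age thresholds) with `DslotX := DX ∘ lvlX` and `hacA`∕`hacB` := `hunion true`∕`hunion false`
  exact shellWeightBound_of_towerData_sync (G := SU2) (PA := P true) (jA := jl true) (PB := P false) (jB := jl false)
    (SA := fun K => (S₀ true K).disjSum (S₁ true K)) (SB := fun K => (S₀ false K).disjSum (S₁ false K))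
    (θA := fun K s => ε true (K - lvl true K s)) (θB := fun K s => ε false (K - lvl false K s))
    (uA := fun K t s U => u true K t s U / η true (jl true K s) ^ 2)
    (uB := fun K t s U => u false K t s U / η false (jl false K s) ^ 2)
    (DslotA := fun K _ s => D true (lvl true K s)) (DslotB := fun K _ s => D false (lvl false K s))
    (hFfin true) sh_nonnegA sh_leA coverA hMA piece_leA total_geA (hD0 true) (hρ0 true) (fun K t _ s _ => le_rfl)
    (hunion true)
    (hFfin false) sh_nonnegB sh_leB coverB hMB piece_leB total_geB (hD0 false) (hρ0 false) (fun K t _ s _ => le_rfl)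
    (hunion false)
    (hw true) (hw false) hϑ0 hϑ1 (hDbar true) (hDbar false) (hrate true) (hrate false)

end Summit.QuantumFields.BalabanUV.T4Continuum.ShellMeasureLiveEndOneCallUnionLevels

end
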